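import Summits.BirchSwinnertonDyer.BirchSwinnertonDyer.Theorems.EisensteinPrimesBSDpOnCellCOfNamedFactsV22
import Summits.BirchSwinnertonDyer.BirchSwinnertonDyer.Theorems.EisensteinPrimesBSDpOnCellCTelescopeCarrierOfAnDistRatOfAlgFPG
import Summits.BirchSwinnertonDyer.BirchSwinnertonDyer.Theorems.EisensteinPrimesBSDpOnCellCTelescopeCarrierAlgOfWitnessFPG
import Summits.BirchSwinnertonDyer.BirchSwinnertonDyer.Theorems.EisensteinPrimesBSDpOnCellCTelescopeHerbrandTranslate
import Summits.BirchSwinnertonDyer.BirchSwinnertonDyer.Theorems.EisensteinPrimesBSDpOnCellCTelescopeCarrierAlgWOfDivIntFPG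
import Summits.BirchSwinnertonDyer.BirchSwinnertonDyer.Theorems.EisensteinPrimesBSDpOnCellCTelescopeK2DivIntOfModuleDivFPG
import Summits.BirchSwinnertonDyer.BirchSwinnertonDyer.Theorems.EisensteinPrimesBSDpOnCellCTelescopeK2ModuleDivOfLeavesFPG
import Summits.BirchSwinnertonDyer.BirchSwinnertonDyer.Theorems.EisensteinPrimesBSDpOnCellCTelescopeBranchLatticeOfPkgG
import Summits.BirchSwinnertonDyer.BirchSwinnertonDyer.Theorems.EisensteinPrimesBSDpOnCellCTelescopeCarrierAnDistRatGalOfGaloisLattice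
import Literature.NumberTheory.EllipticCurves.PNewBranchGaloisLattice
import Summits.BirchSwinnertonDyer.BirchSwinnertonDyer.Theorems.EisensteinPrimesBSDpOnCellCTelescopeK2WeightTwoControlOfPubOfPseudoNullT
import Summits.BirchSwinnertonDyer.BirchSwinnertonDyer.Theorems.EisensteinPrimesBSDpOnCellCTelescopeWeightTwoPseudoNullOfPub
import Summits.BirchSwinnertonDyer.BirchSwinnertonDyer.Theorems.EisensteinPrimesBSDpOnCellCTelescopeK2MemberControlOfModF
import Summits.BirchSwinnertonDyer.BirchSwinnertonDyer.Theorems.EisensteinPrimesBSDpOnCellCTelescopeMemberControlModCofinite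
import Literature.NumberTheory.EllipticCurves.KellerYin2024.HidaMemberAnticyclotomicMainConjecture
import HarnessLib

/-!
# [telescope v17 — successor LEAD cruxlead-19034 g5, 2026-08-30] CRUX 4 `BSDpOnCellC` FROM CITED FACTS AND CRUX 3 — THE CONDITIONAL CLOSURE OF THE TELESCOPE LINE, SORRY-FREE
# Crux 4 `BSDpOnCellC` (stmt-BirchSwinnertonDyer-19034), line «telescope» v17 (`--supports`, helper; CONDITIONAL — closes nothing: the four hypotheses are exactly the
# four registered cite/cross-crux stubs of v17 and are NOT discharged here)

WHAT: `bsdpOnCellC_of_citedFacts (hPub) (hPre) (hGal) (hMazur) : …Theses.EisensteinPrimes.BSDpOnCellC` where `hPub` = the 23 refereed named facts of `stub_publishedFacts`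
(text token for token), `hPre` = the four Keller–Yin 2024 preprint statements of `stub_preprintFacts`, `hGal` = the ONE assembled named fact T-An-2ᵍ
`Literature.NumberTheory.EllipticCurves.hida1986_castella2020_exists_galoisLattice_on_pNewBranchChart` (= `stub_assembledFactsG` of v17), `hMazur` = crux 3
`…Theses.EisensteinPrimes.MazurMCOnCellB` (= `stub_mazurMC_cellB`). PROOF = the v17 skeleton's ONE-LINE composition over LANDED tree theorems with the stubs replaced by the
hypotheses: head `…OfNamedFactsV22.bsdpOnCellC_of_namedFactsV22P` (x2-p2 g18) ∘ ideator g42's FPG chain `TelescopeCarrierOfAnDistRatOfAlgFPG` ∘ `…CarrierAlgOfWitnessFPG` ∘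
`…CarrierAlgWOfDivIntFPG` ∘ `…K2DivIntOfModuleDivFPG` ∘ `…K2ModuleDivOfLeavesFPG` with the analytic slot `TelescopeCarrierAnDistRatGalOfGaloisLattice.carrierAnDistRatGal_of_galoisLattice hGal`
(g42), the lattice slot `TelescopeBranchLatticeOfPkgG.branchLattice_of_pkgG` (LEAD g5 over x2-p2 g23's keystone), the weight-two slot `…WeightTwoPseudoNullOfPub.stub_weightTwoPseudoNullOfPub`
(LEAD g4 over ideator g40; a THEOREM despite its historical name), the member slot `…MemberControlModCofinite.stub_memberControlModCofinite` (x2-p2 g22; a THEOREM) and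
`TelescopeHerbrandTranslate.stub_herbrandTranslate` (x2-p2 g18; a THEOREM). So «crux 4 ⟸ crux 3 + cited facts» is a TREE THEOREM, not only a registered skeleton with sorries.

HONEST FRAMING: CONDITIONAL result — the gate records it as such; it discharges none of its four hypotheses (23 refereed published theorems incl. Gross–Zagier/Kolyvagin/
Skinner–Urban-type inputs; 4 preprint claims; one assembled named fact under referee review with flags T2-hK/TG-p3; crux 3 OPEN); closes no registered stub, no crux, no summit
statement; BSD is proved for no curve by this file. THEOREMS ONLY: no definition, no named fact, no instance, no `sorry`.
References (shape only): [cite: KellerYin2024, Thm. 3.0.8, Thm. 2.2.2 (arXiv:2402.12781v2)] [cite: Castella2020JIMJ, Def. 2.10, Thm. 2.11] [cite: Hida1986, Thm. 2.1]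
[cite: GreenbergVatsal2000, Thm. (1.3)]
-/

set_option autoImplicit false
set_option linter.dupNamespace false

noncomputable section

open scoped Classical MatrixGroups ModularForm

open CongruenceSubgroup WeierstrassCurve NumberField IsDedekindDomain Field PowerSeries
  Literature.NumberTheory.EllipticCurves Literature.NumberTheory.EllipticCurves.GreenbergSelmer
  Literature.NumberTheory.EllipticCurves.ModularForms Literature.NumberTheory.QuadraticFields
  Literature.NumberTheory.EllipticCurves.Rank1Residual
  Literature.NumberTheory.EllipticCurves.Rank1Residual.Typed
  Literature.NumberTheory.EllipticCurves.KrizLi2019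
  Literature.NumberTheory.EllipticCurves.GreenbergVatsal2000
  Literature.NumberTheory.EllipticCurves.Wuthrich2014
  Literature.NumberTheory.EllipticCurves.SteinWuthrich2013
  Literature.NumberTheory.EllipticCurves.Castella2018Exceptional
  Literature.NumberTheory.GaloisRepresentations Literature.NumberTheory.GaloisCohomology
  Literature.NumberTheory.Automorphic
  Summit.BirchSwinnertonDyer.Rank1Residual.X11b.AcSelmer
  Summit.BirchSwinnertonDyer.Rank1Residual.X11b.Halves
  Summit.BirchSwinnertonDyer.Rank1Residual.X11b
  Summit.BirchSwinnertonDyer.Rank1Residual Summit.BirchSwinnertonDyer.Rank1Residual.X1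
  Summit.BirchSwinnertonDyer.Rank1Residual.X2
open Literature.NumberTheory.EllipticCurves.KellerYin2024 (curveLocalLambda)


open Literature.NumberTheory.EllipticCurves.BigGaloisRep


namespace Summit.BirchSwinnertonDyer.BirchSwinnertonDyer.Theorems.EisensteinPrimesBSDpOnCellCOfCitedFactsV17

open Literature.NumberTheory.EllipticCurves.CastellaGrossiLeeSkinner2022 Literature.NumberTheory.EllipticCurves.Castella2018
  Literature.NumberTheory.IwasawaTheory Literature.NumberTheory.IwasawaTheory.Greenberg2016
  Literature.NumberTheory.IwasawaTheory.Greenberg2006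
  Summit.BirchSwinnertonDyer.Rank1Residual.X1.KellerYinMuLambdaSplit
open Literature.NumberTheory.EllipticCurves.KellerYin2024
open Summit.BirchSwinnertonDyer.BirchSwinnertonDyer.Theorems

/-- **Crux 4 `BSDpOnCellC` from the cited facts and crux 3 (telescope v17, conditional closure).** Hypotheses = the texts of v17's four registered stubs
`stub_publishedFacts` (23 refereed named facts) · `stub_preprintFacts` (Keller–Yin 2024 ×4) · `stub_assembledFactsG` (T-An-2ᵍ) · `stub_mazurMC_cellB` (crux 3), token for token;
proof = the skeleton's composition over landed tree theorems. CONDITIONAL: nothing here discharges the hypotheses.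
[cite: KellerYin2024, Thm. 3.0.8, Thm. 2.2.2 (arXiv:2402.12781v2) (shape only)] [cite: Hida1986, Thm. 2.1 (shape only)] [cite: GreenbergVatsal2000, Thm. (1.3) (shape only)] -/
theorem bsdpOnCellC_of_citedFacts
    (hPub :
    ((((lambdaMu_multiplicative_of_gvPar ∧ thm16_charIdeal_dvd_multiplicative_of_reducible ∧
    thm61_splitMultiplicative ∧ thm61_nonsplitMultiplicative ∧
    (∀ (W : WeierstrassCurve ℚ) [W.IsElliptic] [W.IsGloballyMinimal] (p : ℕ) [Fact p.Prime],
      greenberg_stevens (W := W) (p := p)) ∧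
    exists_isNewformOf ∧
    hsieh2014_exists_anticyclotomicPAdicLFunction ∧
    (∀ (N : ℕ) [NeZero N] (W : WeierstrassCurve ℚ) (K : Type) [Field K] [NumberField K],
      gross_zagier N W K) ∧
    (∀ (N : ℕ) [NeZero N] (W : WeierstrassCurve ℚ) (K : Type) [Field K] [NumberField K],
      kolyvagin N W K) ∧
    rank_eq_analyticRank_of_analyticRank_le_one ∧ HoffsteinLuo1997_exists_twist_L_one_ne_zero ∧
    mazur_not_dvd_maninConstant_of_odd ∧ bsdRHS_eq_of_isIsogenous) ∧
    thm210_thm211_bdpDisplay_pNew) ∧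
    LiuZhangZhang2018.thm151_thm153_modularCurve_heegnerVector) ∧
    (prop125_characterGrSelmerDual_torsion_muZero_dim ∧
      cor126_residualCharacter_globalLift ∧ cor126_residualCharacter_localSurjective ∧
      thm212_exists_isKatzLFunction ∧
      Literature.NumberTheory.EllipticCurves.Castella2018.cas20_thm211_memberForms_sigmaFrames_congr)) ∧
      Literature.NumberTheory.EllipticCurves.BCGKPST2020.thm331_rubin_exists_katzMeasure₂_pseudoIso_span_eq ∧
      Literature.NumberTheory.EllipticCurves.DeShalit1987.thmII64_katzMeasure₂_functionalEquation ∧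
      Literature.NumberTheory.EllipticCurves.Hida2010MuInvariant.thmI_mu_katzBranch_reflect_eq_zero)
    (hPre :
    Literature.NumberTheory.EllipticCurves.KellerYin2024.thm308_imc2_hidaMember_dvd_OPEN ∧
      Literature.NumberTheory.EllipticCurves.KellerYin2024.thm222_anacong_hidaMember_sigma_mu_OPEN ∧
      Literature.NumberTheory.EllipticCurves.KellerYin2024.thm222_anacong_hidaMember_sigma_lambda_OPEN ∧
      Literature.NumberTheory.EllipticCurves.KellerYin2024.thm308_imc2_hidaMember_isTorsion_OPEN)
    (hGal :
    Literature.NumberTheory.EllipticCurves.hida1986_castella2020_exists_galoisLattice_on_pNewBranchChart)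
    (hMazur :
    Summit.BirchSwinnertonDyer.BirchSwinnertonDyer.Theses.EisensteinPrimes.MazurMCOnCellB) :
    Summit.BirchSwinnertonDyer.BirchSwinnertonDyer.Theses.EisensteinPrimes.BSDpOnCellC :=
  Summit.BirchSwinnertonDyer.BirchSwinnertonDyer.Theorems.EisensteinPrimesBSDpOnCellCOfNamedFactsV22.bsdpOnCellC_of_namedFactsV22P
    hPub ⟨hPre.1, hPre.2.1, hPre.2.2.1⟩
    (Summit.BirchSwinnertonDyer.BirchSwinnertonDyer.Theorems.TelescopeCarrierOfAnDistRatOfAlgFPG.carrier_of_anDistRat_of_algFP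
      (Summit.BirchSwinnertonDyer.BirchSwinnertonDyer.Theorems.TelescopeCarrierAnDistRatGalOfGaloisLattice.carrierAnDistRatGal_of_galoisLattice
        hGal)
      (Summit.BirchSwinnertonDyer.BirchSwinnertonDyer.Theorems.TelescopeCarrierAlgOfWitnessFPG.carrierAlg_of_witness
        (Summit.BirchSwinnertonDyer.BirchSwinnertonDyer.Theorems.TelescopeCarrierAlgWOfDivIntFPG.carrierAlgW_of_divInt
          (Summit.BirchSwinnertonDyer.BirchSwinnertonDyer.Theorems.TelescopeK2DivIntOfModuleDivFPG.carrierDivInt_of_branchFibreDiv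
            (Summit.BirchSwinnertonDyer.BirchSwinnertonDyer.Theorems.TelescopeK2ModuleDivOfLeavesFPG.branchFibreDiv_of_leaves
              Summit.BirchSwinnertonDyer.BirchSwinnertonDyer.Theorems.TelescopeBranchLatticeOfPkgG.branchLattice_of_pkgG
              (Summit.BirchSwinnertonDyer.BirchSwinnertonDyer.Theorems.TelescopeK2WeightTwoControlOfPubOfPseudoNullT.weightTwoControlOfPub_of_pseudoNull
                Summit.BirchSwinnertonDyer.BirchSwinnertonDyer.Theorems.TelescopeWeightTwoPseudoNullOfPub.stub_weightTwoPseudoNullOfPub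
                hPub)
              (Summit.BirchSwinnertonDyer.BirchSwinnertonDyer.Theorems.TelescopeK2MemberControlOfModF.memberControl_of_mod
                Summit.BirchSwinnertonDyer.BirchSwinnertonDyer.Theorems.TelescopeMemberControlModCofinite.stub_memberControlModCofinite
                hPre.2.2.2))))
        Summit.BirchSwinnertonDyer.BirchSwinnertonDyer.Theorems.TelescopeHerbrandTranslate.stub_herbrandTranslate))
    hMazur

end Summit.BirchSwinnertonDyer.BirchSwinnertonDyer.Theorems.EisensteinPrimesBSDpOnCellCOfCitedFactsV17

end
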